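import Summits.BirchSwinnertonDyer.BirchSwinnertonDyer.Theorems.CyclotomicUntwistFormalEtaCoboundaryIntegral
import Summits.BirchSwinnertonDyer.BirchSwinnertonDyer.Theorems.CyclotomicUntwistNineLogUnbounded
import HarnessLib

/-!
# Route `CyclotomicUntwist`: a bounded-denominator relation `L_η + c·log ∈ 𝓞⟦z⟧ ⊗ ℚ` on a model over
# `𝓞 = 𝓞_{ℚ₃(ζ₉)}` with elliptic special fibre is EXACT: `L_η + c·log ∈ 𝓞⟦z⟧` (peeling along `[3]`)

Cell `pub/bsd-wall` (D-0145 line `route-BirchSwinnertonDyer-CyclotomicUntwist`), prover seat `bsd-line-cycu-p5`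
(gen 10), lane «the η-class is of the second kind», file 4 (input of the UNCONDITIONAL `ClassesIndependent` on
supersingular good models). THEOREMS ONLY (no definition, no named fact, no `sorry`); helper `--supports` K1 =
stmt-BirchSwinnertonDyer-21580. BSD is not proved by this file and no crux is.

For a Weierstrass equation `E` over `𝓞 = ONine` with elliptic special fibre `E ⊗_ρ 𝔽₃` and `𝓔 = E ⊗ ℚ₃(ζ₉)`, with
`L_η = formalEtaIntegral 𝓔` (the class of `η = x·ω`) and `log = formalLog 𝓔`:

* §1 `exists_eq_C_varpi_mul_of_functional_eq_mod` / `exists_eq_C_varpi_pow_mul` — PEELING: an `𝓞`-series `L` with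
  `L([3]_E z) = 3·L(z) + ϖ^{j+1}·M` (`ϖ = 1 − ζ₉`) is `ϖ·L₁` with `L₁([3]) = 3L₁ + ϖ^j M` (reduce mod `ρ`: `L̄([3]_Ē) = 0`,
  `[3]_Ē ≠ 0` — `NineLogUnbounded.formalMul_three_map_ne_zero`); iterating, `L([3]) = 3L + ϖ^j M ⇒ ϖ^j ∣ L`;
* §2 `formalEtaIntegral_subst_pair`, `formalEtaIntegral_subst_formalMul_three` — the functional equation of `L_η`
  along `[3] = F(F(z,z),z)`: `L_η([3]z) = 3·L_η(z) + ∂L_η(F(z,z), z) + ∂L_η(z, z)`, `∂L_η` the (integral, Part III)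
  coboundary;
* §3 **`exists_map_eq_of_hbd`** — if `L_η + c·log` has bounded denominators (`3ᵈ·(L_η + c·log) ∈ 𝓞⟦z⟧`) then in
  fact `L_η + c·log = G.map ι` for an `𝓞`-series `G`: the functional equation `B([3]) = 3B + 3ᵈ·I` (`I` integral,
  `B = 3ᵈ(L_η + c log)`; `log([3]) = 3 log`) with `3ᵈ = ϖ^{6d}·unit` peels `6d` times.
[cite: Katz1981CrystallineDieudonne, §5.1 (p. 193), Cor. 5.1.8 and Thm. 5.3.3] [cite: SilvermanAEC2009, IV.2.3]
-/

set_option autoImplicit false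
-- single-conjunct summit: `Summit.BirchSwinnertonDyer.BirchSwinnertonDyer.…` repeats the name by design
set_option linter.dupNamespace false

noncomputable section

open scoped Classical
open PowerSeries IsCyclotomicExtension Literature.NumberTheory.EllipticCurves
  Literature.NumberTheory.EllipticCurves.DescendedFrobenius
  Summit.BirchSwinnertonDyer.BirchSwinnertonDyer.Theorems.NineIntegers
  Summit.BirchSwinnertonDyer.BirchSwinnertonDyer.Theorems.NineHondaEstimate
  Summit.BirchSwinnertonDyer.BirchSwinnertonDyer.Theorems.NineLogUnbounded

namespace Summit.BirchSwinnertonDyer.BirchSwinnertonDyer.Theorems.NineEtaIntegrality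

/-! ## §1 Peeling along `[3]` with an error term divisible by `ϖ` -/

/-- **One peeling step.** If `L([3]_E) = 3L + ϖ^{j+1}·M` in `𝓞⟦z⟧` (elliptic special fibre), then `L = ϖ·L₁` with
`L₁([3]_E) = 3L₁ + ϖ^j·M`: modulo `ρ` the equation reads `L̄([3]_Ē) = 0` with `[3]_Ē ≠ 0`, so `L̄ = 0`.
[cite: Katz1981CrystallineDieudonne, Cor. 5.1.8] -/
theorem exists_eq_C_varpi_mul_of_functional_eq_mod (E : WeierstrassCurve ONine) (ρ : ONine →+* ZMod 3)
    [(E.map ρ).IsElliptic] {L M : ONine⟦X⟧} {j : ℕ}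
    (hL : L.subst (E.formalMul 3) = 3 * L +
      PowerSeries.C ((⟨1 - zeta 9 ℚ_[3] KNine, one_sub_zeta_mem⟩ : ONine) ^ (j + 1)) * M) :
    ∃ L₁ : ONine⟦X⟧, L = PowerSeries.C (⟨1 - zeta 9 ℚ_[3] KNine, one_sub_zeta_mem⟩ : ONine) * L₁ ∧
      L₁.subst (E.formalMul 3) = 3 * L₁ +
        PowerSeries.C ((⟨1 - zeta 9 ℚ_[3] KNine, one_sub_zeta_mem⟩ : ONine) ^ j) * M := by
  set ϖ : ONine := ⟨1 - zeta 9 ℚ_[3] KNine, one_sub_zeta_mem⟩ with hϖ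
  have hρϖ : ρ ϖ = 0 := residueMap_one_sub_zeta ρ
  -- reduce the functional equation mod `ρ`
  have hred : (L.map ρ).subst ((E.formalMul 3).map ρ) = 0 := by
    have h := congrArg (PowerSeries.map ρ) hL
    rw [WeierstrassCurve.powerSeries_map_subst ρ (E.hasSubst_formalMul 3), map_add, map_mul, map_mul, map_C,
      map_pow, hρϖ, zero_pow (Nat.succ_ne_zero j), map_zero, zero_mul, add_zero,
      show (PowerSeries.map ρ) (3 : ONine⟦X⟧) = 0 by
        rw [show (3 : ONine⟦X⟧) = PowerSeries.C (3 : ONine) from (map_ofNat _ 3).symm, map_C, map_ofNat,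
          show (3 : ZMod 3) = 0 from rfl, map_zero], zero_mul] at h
    exact h
  have hL0 : L.map ρ = 0 := by
    by_contra hne
    exact subst_ne_zero hne (formalMul_three_map_ne_zero E ρ)
      (by rw [← coeff_zero_eq_constantCoeff, coeff_map, coeff_zero_eq_constantCoeff, E.constantCoeff_formalMul,
        map_zero]) hred
  obtain ⟨L₁, hL₁⟩ := exists_eq_C_varpi_mul_of_map_eq_zero ρ hL0
  refine ⟨L₁, hL₁, ?_⟩
  have hϖ0 : (PowerSeries.C ϖ : ONine⟦X⟧) ≠ 0 := by
    intro h0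
    have hϖz : ϖ = 0 := by
      have := congrArg constantCoeff h0
      rwa [constantCoeff_C, map_zero] at this
    exact varpi_ne_zero hϖz
  have hs : HasSubst (E.formalMul 3) := E.hasSubst_formalMul 3
  have e : (PowerSeries.C ϖ * L₁).subst (E.formalMul 3) = PowerSeries.C ϖ * L₁.subst (E.formalMul 3) := by
    rw [← coe_substAlgHom hs, map_mul, C_eq_algebraMap, AlgHom.commutes]
  have h := hL
  rw [hL₁, e] at h
  refine mul_left_cancel₀ hϖ0 ?_
  rw [map_pow] at h ⊢
  linear_combination h

/-- **Peeling, iterated**: `L([3]_E) = 3L + ϖ^j·M` forces `ϖ^j ∣ L` in `𝓞⟦z⟧`. [cite: Katz1981CrystallineDieudonne, Cor. 5.1.8] -/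
theorem exists_eq_C_varpi_pow_mul (E : WeierstrassCurve ONine) (ρ : ONine →+* ZMod 3) [(E.map ρ).IsElliptic]
    (j : ℕ) {L M : ONine⟦X⟧}
    (hL : L.subst (E.formalMul 3) = 3 * L +
      PowerSeries.C ((⟨1 - zeta 9 ℚ_[3] KNine, one_sub_zeta_mem⟩ : ONine) ^ j) * M) :
    ∃ Lj : ONine⟦X⟧, L = PowerSeries.C ((⟨1 - zeta 9 ℚ_[3] KNine, one_sub_zeta_mem⟩ : ONine) ^ j) * Lj := by
  induction j generalizing L with
  | zero => exact ⟨L, by rw [pow_zero, map_one, one_mul]⟩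
  | succ j ih =>
    obtain ⟨L₁, hL₁, hF₁⟩ := exists_eq_C_varpi_mul_of_functional_eq_mod E ρ hL
    obtain ⟨Lj, hLj⟩ := ih hF₁
    exact ⟨Lj, by rw [hL₁, hLj, pow_succ', map_mul, mul_assoc]⟩

/-! ## §2 The functional equation of `L_η` along `[2] = F(z,z)` and `[3] = F([2]z, z)` -/

section RatAlgebra

variable {A : Type*} [CommRing A] [Algebra ℚ A] [IsDomain A] (V : WeierstrassCurve A)

omit [IsDomain A] in
/-- `L_η(F(g, h)) = ∂L_η(g, h) + L_η(g) + L_η(h)` for series `g, h` without constant term (definition of the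
coboundary `∂L_η`, composed with the substitution `(z₁, z₂) ↦ (g, h)`). [cite: Katz1981CrystallineDieudonne, §5.1 (p. 193)] -/
theorem formalEtaIntegral_subst_pair {σ : Type*} {g h : MvPowerSeries σ A}
    (hg : MvPowerSeries.constantCoeff g = 0) (hh : MvPowerSeries.constantCoeff h = 0) :
    V.formalEtaIntegral.subst (MvPowerSeries.subst ![g, h] V.formalGroupLaw) =
      MvPowerSeries.subst ![g, h] (V.formalEtaIntegral.subst V.formalGroupLaw -
          V.formalEtaIntegral.subst (MvPowerSeries.X 0 : MvPowerSeries (Fin 2) A) -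
          V.formalEtaIntegral.subst (MvPowerSeries.X 1 : MvPowerSeries (Fin 2) A)) +
        V.formalEtaIntegral.subst g + V.formalEtaIntegral.subst h := by
  have hs := WeierstrassCurve.hasSubst_pair hg hh
  rw [← mvSubst_powerSeries_subst V.hasSubst_formalGroupLaw hs, MvPowerSeries.subst_sub hs,
    MvPowerSeries.subst_sub hs, mvSubst_powerSeries_subst (PowerSeries.HasSubst.X 0) hs,
    mvSubst_powerSeries_subst (PowerSeries.HasSubst.X 1) hs, MvPowerSeries.subst_X hs, MvPowerSeries.subst_X hs]
  simp only [Matrix.cons_val_zero, Matrix.cons_val_one]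
  ring

omit [IsDomain A] in
/-- `L_η ∘ z = L_η`. [folklore] -/
theorem formalEtaIntegral_subst_X : V.formalEtaIntegral.subst (PowerSeries.X : A⟦X⟧) = V.formalEtaIntegral := by
  rw [← PowerSeries.map_algebraMap_eq_subst_X, Algebra.algebraMap_self, PowerSeries.map_id, id]

omit [IsDomain A] in
/-- **`L_η([3]z) = 3·L_η(z) + ∂L_η([2]z, z) + ∂L_η(z, z)`** (`[2] = F(z,z)`, `[3] = F([2]z, z)`).
[cite: SilvermanAEC2009, IV.2.3] [cite: Katz1981CrystallineDieudonne, §5.1 (p. 193)] -/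
theorem formalEtaIntegral_subst_formalMul_three :
    V.formalEtaIntegral.subst (V.formalMul 3) = 3 * V.formalEtaIntegral +
      (MvPowerSeries.subst ![V.formalMul 2, (PowerSeries.X : A⟦X⟧)] (V.formalEtaIntegral.subst V.formalGroupLaw -
          V.formalEtaIntegral.subst (MvPowerSeries.X 0 : MvPowerSeries (Fin 2) A) -
          V.formalEtaIntegral.subst (MvPowerSeries.X 1 : MvPowerSeries (Fin 2) A)) +
        MvPowerSeries.subst ![(PowerSeries.X : A⟦X⟧), (PowerSeries.X : A⟦X⟧)]
          (V.formalEtaIntegral.subst V.formalGroupLaw -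
            V.formalEtaIntegral.subst (MvPowerSeries.X 0 : MvPowerSeries (Fin 2) A) -
            V.formalEtaIntegral.subst (MvPowerSeries.X 1 : MvPowerSeries (Fin 2) A))) := by
  have h2 : V.formalMul 2 = MvPowerSeries.subst ![(PowerSeries.X : A⟦X⟧), (PowerSeries.X : A⟦X⟧)] V.formalGroupLaw := by
    rw [show (2 : ℕ) = 1 + 1 from rfl, V.formalMul_succ, V.formalMul_one]
  rw [show (3 : ℕ) = 2 + 1 from rfl, V.formalMul_succ,
    formalEtaIntegral_subst_pair V (V.constantCoeff_formalMul 2) PowerSeries.constantCoeff_X, h2,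
    formalEtaIntegral_subst_pair V PowerSeries.constantCoeff_X PowerSeries.constantCoeff_X, formalEtaIntegral_subst_X]
  ring

end RatAlgebra

/-! ## §3 A bounded-denominator relation `L_η + c·log` is exact -/

/-- The correction term `∂L_η([2]z, z) + ∂L_η(z, z)` of `𝓔 = E ⊗ ℚ₃(ζ₉)` is the base change of an `𝓞`-series
(Part III: `∂L_η = map ι (closed form of E)`). [cite: Katz1981CrystallineDieudonne, §5.1 (p. 193)] -/
theorem correction_eq_map (E : WeierstrassCurve ONine) :
    MvPowerSeries.subst ![(E.map (algebraMap ONine KNine)).formalMul 2, (PowerSeries.X : KNine⟦X⟧)]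
        ((E.map (algebraMap ONine KNine)).formalEtaIntegral.subst (E.map (algebraMap ONine KNine)).formalGroupLaw -
          (E.map (algebraMap ONine KNine)).formalEtaIntegral.subst (MvPowerSeries.X 0 : MvPowerSeries (Fin 2) KNine) -
          (E.map (algebraMap ONine KNine)).formalEtaIntegral.subst (MvPowerSeries.X 1 : MvPowerSeries (Fin 2) KNine)) +
      MvPowerSeries.subst ![(PowerSeries.X : KNine⟦X⟧), (PowerSeries.X : KNine⟦X⟧)]
        ((E.map (algebraMap ONine KNine)).formalEtaIntegral.subst (E.map (algebraMap ONine KNine)).formalGroupLaw -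
          (E.map (algebraMap ONine KNine)).formalEtaIntegral.subst (MvPowerSeries.X 0 : MvPowerSeries (Fin 2) KNine) -
          (E.map (algebraMap ONine KNine)).formalEtaIntegral.subst (MvPowerSeries.X 1 : MvPowerSeries (Fin 2) KNine)) =
    PowerSeries.map (algebraMap ONine KNine)
      (MvPowerSeries.subst ![E.formalMul 2, (PowerSeries.X : ONine⟦X⟧)]
          (MvPowerSeries.C E.a₁ - (MvPowerSeries.C E.a₁ + MvPowerSeries.C E.a₃ * E.formalSlope +
              MvPowerSeries.C E.a₄ * E.formalIntercept + 2 * MvPowerSeries.C E.a₆ * E.formalSlope * E.formalIntercept) *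
            MvPowerSeries.invOfUnit (1 - MvPowerSeries.C E.a₃ * E.formalIntercept -
              MvPowerSeries.C E.a₆ * E.formalIntercept ^ 2) 1 +
            MvPowerSeries.C E.a₃ * (E.formalChordZ ^ 2 * E.formalWDivCube.subst E.formalChordZ)) +
        MvPowerSeries.subst ![(PowerSeries.X : ONine⟦X⟧), (PowerSeries.X : ONine⟦X⟧)]
          (MvPowerSeries.C E.a₁ - (MvPowerSeries.C E.a₁ + MvPowerSeries.C E.a₃ * E.formalSlope +
              MvPowerSeries.C E.a₄ * E.formalIntercept + 2 * MvPowerSeries.C E.a₆ * E.formalSlope * E.formalIntercept) *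
            MvPowerSeries.invOfUnit (1 - MvPowerSeries.C E.a₃ * E.formalIntercept -
              MvPowerSeries.C E.a₆ * E.formalIntercept ^ 2) 1 +
            MvPowerSeries.C E.a₃ * (E.formalChordZ ^ 2 * E.formalWDivCube.subst E.formalChordZ))) := by
  set ι := algebraMap ONine KNine with hι
  rw [FormalEtaCoboundary.coboundary_eq_map E ι]
  have h2 : MvPowerSeries.HasSubst ![E.formalMul 2, (PowerSeries.X : ONine⟦X⟧)] :=
    WeierstrassCurve.hasSubst_pair (E.constantCoeff_formalMul 2) PowerSeries.constantCoeff_X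
  have hX : MvPowerSeries.HasSubst ![(PowerSeries.X : ONine⟦X⟧), (PowerSeries.X : ONine⟦X⟧)] :=
    WeierstrassCurve.hasSubst_pair PowerSeries.constantCoeff_X PowerSeries.constantCoeff_X
  have e1 : (fun i => MvPowerSeries.map ι ((![E.formalMul 2, (PowerSeries.X : ONine⟦X⟧)] : Fin 2 → ONine⟦X⟧) i)) =
      ![(E.map ι).formalMul 2, (PowerSeries.X : KNine⟦X⟧)] := by
    funext i; fin_cases i
    · show PowerSeries.map ι (E.formalMul 2) = (E.map ι).formalMul 2
      exact WeierstrassCurve.map_formalMul E ι 2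
    · show PowerSeries.map ι PowerSeries.X = PowerSeries.X
      exact PowerSeries.map_X ι
  have e2 : (fun i => MvPowerSeries.map ι ((![(PowerSeries.X : ONine⟦X⟧), (PowerSeries.X : ONine⟦X⟧)] :
      Fin 2 → ONine⟦X⟧) i)) = ![(PowerSeries.X : KNine⟦X⟧), (PowerSeries.X : KNine⟦X⟧)] := by
    funext i; fin_cases i
    · show PowerSeries.map ι PowerSeries.X = PowerSeries.X
      exact PowerSeries.map_X ι
    · show PowerSeries.map ι PowerSeries.X = PowerSeries.X
      exact PowerSeries.map_X ι
  symm
  change MvPowerSeries.map ι (_ + _) = _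
  rw [map_add, MvPowerSeries.map_subst h2, MvPowerSeries.map_subst hX, e1, e2]

/-- **A bounded-denominator relation between `L_η` and `log` is exact.** For a Weierstrass equation `E` over
`𝓞 = 𝓞_{ℚ₃(ζ₉)}` with elliptic special fibre and `𝓔 = E ⊗ ℚ₃(ζ₉)`: if `L_η + c·log_𝓔` has bounded denominators
(`c ∈ ℚ₃(ζ₉)`), then `L_η + c·log_𝓔 = G ⊗ 1` for an `𝓞`-series `G` — no denominators at all. Proof: `B = 3ᵈ(L_η +
c log) ∈ 𝓞⟦z⟧` satisfies `B([3]) = 3B + 3ᵈ·I` with `I = ∂L_η([2]z,z) + ∂L_η(z,z)` integral and `log([3]) = 3 log`;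
`3ᵈ = ϖ^{6d}·unit`, so `6d` peeling steps give `ϖ^{6d} ∣ B`. [cite: Katz1981CrystallineDieudonne, Cor. 5.1.8 and Thm. 5.3.3] -/
theorem exists_map_eq_of_hbd (E : WeierstrassCurve ONine) (ρ : ONine →+* ZMod 3) [(E.map ρ).IsElliptic] (c : KNine)
    (h : HasBoundedDenominators ((E.map (algebraMap ONine KNine)).formalEtaIntegral +
      PowerSeries.C c * (E.map (algebraMap ONine KNine)).formalLog)) :
    ∃ G : ONine⟦X⟧, (E.map (algebraMap ONine KNine)).formalEtaIntegral +
      PowerSeries.C c * (E.map (algebraMap ONine KNine)).formalLog = G.map (algebraMap ONine KNine) := by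
  set ι := algebraMap ONine KNine with hι
  set 𝓔 := E.map ι with h𝓔
  set ϖ : ONine := ⟨1 - zeta 9 ℚ_[3] KNine, one_sub_zeta_mem⟩ with hϖ
  set Gη := 𝓔.formalEtaIntegral + PowerSeries.C c * 𝓔.formalLog with hGη
  obtain ⟨d, hd⟩ := h
  -- lift `3ᵈ (L_η + c log)` to `𝓞⟦X⟧`
  set L : ONine⟦X⟧ := PowerSeries.mk fun n => (⟨(3 : KNine) ^ d * coeff n Gη, hd n⟩ : ONine) with hLdef
  have hL : L.map ι = PowerSeries.C ((3 : KNine) ^ d) * Gη := by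
    ext n
    rw [coeff_map, hLdef, coeff_mk, coeff_C_mul]
    rfl
  -- the correction term and its lift
  obtain ⟨I, hI⟩ : ∃ I : ONine⟦X⟧, MvPowerSeries.subst ![𝓔.formalMul 2, (PowerSeries.X : KNine⟦X⟧)]
        (𝓔.formalEtaIntegral.subst 𝓔.formalGroupLaw -
          𝓔.formalEtaIntegral.subst (MvPowerSeries.X 0 : MvPowerSeries (Fin 2) KNine) -
          𝓔.formalEtaIntegral.subst (MvPowerSeries.X 1 : MvPowerSeries (Fin 2) KNine)) +
      MvPowerSeries.subst ![(PowerSeries.X : KNine⟦X⟧), (PowerSeries.X : KNine⟦X⟧)]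
        (𝓔.formalEtaIntegral.subst 𝓔.formalGroupLaw -
          𝓔.formalEtaIntegral.subst (MvPowerSeries.X 0 : MvPowerSeries (Fin 2) KNine) -
          𝓔.formalEtaIntegral.subst (MvPowerSeries.X 1 : MvPowerSeries (Fin 2) KNine)) = I.map ι :=
    ⟨_, correction_eq_map E⟩
  -- the functional equation over `ℚ₃(ζ₉)`: `Gη([3]) = 3 Gη + I`
  have hs𝓔 : HasSubst (𝓔.formalMul 3) := 𝓔.hasSubst_formalMul 3
  have hFEK : Gη.subst (𝓔.formalMul 3) = 3 * Gη + I.map ι := by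
    rw [hGη, ← coe_substAlgHom hs𝓔, map_add, map_mul, C_eq_algebraMap, AlgHom.commutes, coe_substAlgHom,
      formalEtaIntegral_subst_formalMul_three 𝓔, 𝓔.formalLog_subst_formalMul_rat 3, hI, nsmul_eq_mul,
      ← C_eq_algebraMap]
    push_cast
    ring
  -- the functional equation in `𝓞⟦X⟧`: `L([3]) = 3L + 3ᵈ·I`
  have hinj : Function.Injective (PowerSeries.map ι) := PowerSeries.map_injective ι Subtype.val_injective
  have hmap3 : (PowerSeries.map ι) (3 : ONine⟦X⟧) = 3 := by
    rw [show (3 : ONine⟦X⟧) = PowerSeries.C (3 : ONine) from (map_ofNat _ 3).symm, map_C, map_ofNat, map_ofNat]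
  have hFE : L.subst (E.formalMul 3) = 3 * L + PowerSeries.C ((3 : ONine) ^ d) * I := by
    apply hinj
    rw [WeierstrassCurve.powerSeries_map_subst ι (E.hasSubst_formalMul 3), WeierstrassCurve.map_formalMul, ← h𝓔,
      map_add, map_mul (PowerSeries.map ι) 3 L, hmap3, map_mul, map_C, map_pow, hL, ← coe_substAlgHom hs𝓔, map_mul,
      C_eq_algebraMap, AlgHom.commutes, coe_substAlgHom, hFEK, ← C_eq_algebraMap]
    have : ι 3 = 3 := map_ofNat ι 3
    rw [this]
    ring
  -- `3 = ϖ⁶ · ε` with `ε` a unit of `𝓞`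
  set ε : ONine := -⟨_, thetaInv_mem⟩ with hε
  set ε' : ONine := -⟨_, theta_mem⟩ with hε'
  have h3 : (3 : ONine) = ϖ ^ 6 * ε := by
    apply Subtype.ext
    rw [hϖ, hε]
    push_cast
    rw [three_eq_neg_pow_six_mul_thetaInv zeta_spec]
    ring
  have hεε' : ε * ε' = 1 := by
    rw [hε, hε', neg_mul_neg]
    apply Subtype.ext
    push_cast
    rw [mul_comm]
    exact theta_mul_thetaInv zeta_spec
  -- rewrite `3ᵈ = ϖ^(6d) ε^d` and peel
  have hFE' : L.subst (E.formalMul 3) = 3 * L + PowerSeries.C (ϖ ^ (6 * d)) * (PowerSeries.C (ε ^ d) * I) := by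
    rw [hFE, h3, mul_pow, ← pow_mul, map_mul, mul_assoc]
  obtain ⟨L', hL'⟩ := exists_eq_C_varpi_pow_mul E ρ (6 * d) hFE'
  -- back over `ℚ₃(ζ₉)`: `3ᵈ Gη = ϖ^(6d) L'`, and `3ᵈ = ϖ^(6d) ε^d`
  refine ⟨PowerSeries.C (ε' ^ d) * L', ?_⟩
  have hϖK : (ι (ϖ ^ (6 * d))) ≠ 0 := by
    rw [map_pow]
    refine pow_ne_zero _ fun h0 => varpi_ne_zero (Subtype.ext ?_)
    rw [ZeroMemClass.coe_zero]
    exact h0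
  have e3 : (3 : KNine) ^ d = ι (ϖ ^ (6 * d)) * ι (ε ^ d) := by
    calc (3 : KNine) ^ d = (ι 3) ^ d := by rw [map_ofNat]
      _ = ι (3 ^ d) := (map_pow ι 3 d).symm
      _ = ι (ϖ ^ (6 * d) * ε ^ d) := by rw [h3, mul_pow, ← pow_mul]
      _ = ι (ϖ ^ (6 * d)) * ι (ε ^ d) := map_mul ι _ _
  have key : PowerSeries.C (ι (ϖ ^ (6 * d))) * (PowerSeries.C (ι (ε ^ d)) * Gη) =
      PowerSeries.C (ι (ϖ ^ (6 * d))) * L'.map ι := by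
    rw [← mul_assoc, ← map_mul, ← e3, ← hL, hL', map_mul, map_C]
  have hC0 : (PowerSeries.C (ι (ϖ ^ (6 * d))) : KNine⟦X⟧) ≠ 0 := by
    intro h0
    apply hϖK
    have := congrArg constantCoeff h0
    rwa [constantCoeff_C, map_zero] at this
  have h4 := mul_left_cancel₀ hC0 key
  calc Gη = PowerSeries.C (ι (ε' ^ d)) * (PowerSeries.C (ι (ε ^ d)) * Gη) := by
        rw [← mul_assoc, ← map_mul, ← map_mul, ← mul_pow, mul_comm ε' ε, hεε', one_pow, map_one, map_one, one_mul]
    _ = PowerSeries.C (ι (ε' ^ d)) * L'.map ι := by rw [h4]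
    _ = (PowerSeries.C (ε' ^ d) * L').map ι := by rw [map_mul, map_C]

end Summit.BirchSwinnertonDyer.BirchSwinnertonDyer.Theorems.NineEtaIntegrality

end
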